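import Summits.NavierStokesRegularity.FluidComputer.ClayBlowupSingularSliceHausdorffOne
import Literature.Analysis.FluidPDE.ESSLocalHolderTopCylinder
import HarnessLib

/-!
# THE ESCAURIAZA–SEREGIN–ŠVERÁK ROW FOR UNFORCED CLAY BLOW-UPS: `L³` CONCENTRATES AT EVERY SINGULAR
# POINT, AND `limsup_{t↑T} ‖u(t)‖_{L³(ℝ³)} = ∞`

Cell `ns-blowup`, seat `ns-blowup-ecbridge-2` (g7; the E–C endpoint theory seat). LABEL: E–C typing,
(A)-side (KERNEL — no named fact). WHAT THIS IS NOT: not Navier–Stokes evidence — necessary conditions on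
the TYPE `ClayBlowup ν` with zero force (its inhabitants would be exactly the counterexamples to
Fefferman's (A)); none is claimed. Companion memo:
`run/shared/lean/pub/ns-blowup/ecbridge2/ECBRIDGE-2-MEMO-6.md` §2 (row R3, unforced).

## Content

MEMO-1 … MEMO-5 listed R3 — the `L³` endpoint at the blow-up time — as «deep». The tree PROVES
Escauriaza–Seregin–Šverák's local theorem (ESS 2003, Thm. 1.4: `ess_local_holder_holds`), and
`ESSLocalHolderTopCylinder.lean` (this seat) puts it at the top of a backward cylinder of any size and
viscosity (`ess_bounded_near_top_of_L3`). Fed with g6's through-`T` classes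
(`ClayBlowup.exists_isLRSuitableWeakSolutionOn_cylinder_top`), for an UNFORCED Clay blow-up:

* `ClayBlowup.isBackwardBoundedAt_of_L3_bound` — if `u ∈ L^∞(T - r², T; L³(B_r(x₀)))` for some
  `0 < r`, `r² ≤ T`, then `u` is backward bounded at `(T, x₀)` (ESS at the top + continuity below `T`);
* **`ClayBlowup.L3_concentration`** — at every SINGULAR point `x₀` of the final slice and every scale
  `r`, the local `L³` norm is essentially unbounded on `(T - r², T)`:
  `¬ ∀ᵐ t ∈ (T - r², T), ∫_{B_r(x₀)} |u(t)|³ ≤ C`, for every `C`; pointwise form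
  `L3_concentration_frequently`: for every `C` and every `t₀ < T` there is `t ∈ (t₀, T)` with
  `∫_{B_r(x₀)} |u(t)|³ > C`;
* **`ClayBlowup.limsup_L3_eq_top`** — the ESS endpoint row: `∫_{ℝ³} |u(t)|³` is unbounded as `t ↑ T`
  (for every `C` and `t₀ < T` some `t ∈ (t₀, T)` has `∫ |u(t)|³ > C`): an unforced Clay blow-up is
  never bounded in the critical space `L^∞_t L³_x` near its lifespan;
* the `DesignedBlowup` twins and the (A)-reading `not_navierStokesRegularity_witness_L3_unbounded`.

The forced case ((C) type) would need ESS's theorem with a force and is not claimed.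

References: L. Escauriaza, G. Seregin, V. Šverák, Russ. Math. Surveys 58 (2003), Thms. 1.3–1.4, §3
[cite: EscauriazaSereginSverak2003, Thm. 1.3 and Thm. 1.4]; G. Seregin, *Lecture notes on regularity
theory for the Navier–Stokes equations* (2014) [cite: Seregin2014, Ch. 6]; C. L. Fefferman, Clay
problem description, (A) [cite: FeffermanClay2006, (A)].
-/

noncomputable section

namespace Summit.NavierStokesRegularity.FluidComputer

open Set MeasureTheory Filter Topology Function TopologicalSpace Metric
open scoped ENNReal NNReal
open Literature.Analysis.FluidPDE
open Summit.NavierStokesRegularity.NavierStokesRegularity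
open Summit.NavierStokesRegularity.FluidComputer.PalasekTowerClayBridge

namespace ClayBlowup

variable {ν : ℝ} (X : ClayBlowup ν)

/-! ## §1 `L^∞_t L³_x` near `(T, x₀)` forces backward boundedness -/

/-- **ESS AT THE TOP OF THE LIFESPAN**: for an unforced Clay blow-up at `ν > 0`, if
`∫_{B_r(x₀)} |u(t)|³ ≤ C` for a.e. `t ∈ (T - r², T)` (`0 < r`, `r² ≤ T`), then `u` is backward bounded
at `(T, x₀)`. The §14.3 datum on `Q_r(T, x₀)` is g6's `exists_isLRSuitableWeakSolutionOn_cylinder_top`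
(zero force), `ess_bounded_near_top_of_L3` bounds `u` essentially on a backward cylinder at `(T, x₀)`,
and an essential bound is a pointwise one below `T` (`isBackwardSingularPoint_of_not_isBackwardBoundedAt`).
No named fact. [cite: EscauriazaSereginSverak2003, Thm. 1.4 and §3] -/
theorem isBackwardBoundedAt_of_L3_bound (hν : 0 < ν) (hf : X.f = 0)
    {x₀ : EuclideanSpace ℝ (Fin 3)} {r : ℝ} (hr : 0 < r) (hrT : r ^ 2 ≤ X.T)
    (hL3 : ∃ C : ℝ≥0, ∀ᵐ t ∂(volume.restrict (Ioo (X.T - r ^ 2) X.T)),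
      ∫⁻ x in ball x₀ r, ‖X.u t x‖ₑ ^ 3 ≤ C) :
    IsBackwardBoundedAt X.u X.T x₀ := by
  obtain ⟨G, hLR⟩ := X.exists_isLRSuitableWeakSolutionOn_cylinder_top hν x₀ hr hrT
  rw [hf] at hLR
  obtain ⟨r₁, hr₁, hbd⟩ := ess_bounded_near_top_of_L3 hν hLR hL3 ((X.T : ℝ), x₀)
    ⟨by simp only; nlinarith, le_rfl⟩ (mem_ball_self hr)
  by_contra h
  exact (X.isBackwardSingularPoint_of_not_isBackwardBoundedAt h r₁ hr₁ ▸ hbd).ne rfl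

/-! ## §2 `L³` concentration at the singular points -/

/-- **`L³` CONCENTRATES AT EVERY SINGULAR POINT OF AN UNFORCED CLAY BLOW-UP**: if `u` is not backward
bounded at `(T, x₀)`, then for every scale `0 < r`, `r² ≤ T`, and every `C`, it is NOT the case that
`∫_{B_r(x₀)} |u(t)|³ ≤ C` for a.e. `t ∈ (T - r², T)` (the local `L^∞_t L³_x` norm at `(T, x₀)` is
infinite at every scale). No named fact. [cite: EscauriazaSereginSverak2003, Thm. 1.4 and §3] -/
theorem L3_concentration (hν : 0 < ν) (hf : X.f = 0) {x₀ : EuclideanSpace ℝ (Fin 3)}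
    (hx₀ : ¬ IsBackwardBoundedAt X.u X.T x₀) {r : ℝ} (hr : 0 < r) (hrT : r ^ 2 ≤ X.T) (C : ℝ≥0) :
    ¬ ∀ᵐ t ∂(volume.restrict (Ioo (X.T - r ^ 2) X.T)), ∫⁻ x in ball x₀ r, ‖X.u t x‖ₑ ^ 3 ≤ C :=
  fun h => hx₀ (X.isBackwardBoundedAt_of_L3_bound hν hf hr hrT ⟨C, h⟩)

/-- **Pointwise form of the `L³` concentration**: at a singular point `x₀`, for every radius `r > 0`,
every finite bound `C` and every `t₀ < T` there is a time `t ∈ (t₀, T)`, `t ≥ 0`, with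
`∫_{B_r(x₀)} |u(t)|³ > C` (apply `L3_concentration` at the scale `min r √(T - max t₀ 0)`).
No named fact. [cite: EscauriazaSereginSverak2003, Thm. 1.3 and Thm. 1.4] -/
theorem L3_concentration_frequently (hν : 0 < ν) (hf : X.f = 0) {x₀ : EuclideanSpace ℝ (Fin 3)}
    (hx₀ : ¬ IsBackwardBoundedAt X.u X.T x₀) {r : ℝ} (hr : 0 < r) (C : ℝ≥0) {t₀ : ℝ}
    (ht₀ : t₀ < X.T) :
    ∃ t ∈ Ioo t₀ X.T, 0 ≤ t ∧ (C : ℝ≥0∞) < ∫⁻ x in ball x₀ r, ‖X.u t x‖ₑ ^ 3 := by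
  have hT := X.T_pos
  set s₀ : ℝ := max t₀ 0 with hs₀
  have hs₀T : s₀ < X.T := max_lt ht₀ hT
  have hs₀0 : 0 ≤ s₀ := le_max_right _ _
  have hs₀t : t₀ ≤ s₀ := le_max_left _ _
  set r' : ℝ := min r (Real.sqrt (X.T - s₀)) with hr'
  have hr'0 : 0 < r' := lt_min hr (Real.sqrt_pos.2 (sub_pos.2 hs₀T))
  have hr'r : r' ≤ r := min_le_left _ _
  have hr'sq : r' ^ 2 ≤ X.T - s₀ := by
    calc r' ^ 2 ≤ Real.sqrt (X.T - s₀) ^ 2 := pow_le_pow_left₀ hr'0.le (min_le_right _ _) 2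
      _ = X.T - s₀ := Real.sq_sqrt (sub_nonneg.2 hs₀T.le)
  have hr'T : r' ^ 2 ≤ X.T := by linarith
  have hnot := X.L3_concentration hν hf hx₀ hr'0 hr'T C
  by_contra hall
  push Not at hall
  apply hnot
  rw [ae_restrict_iff' measurableSet_Ioo]
  refine ae_of_all _ fun t ht => ?_
  have ht0 : 0 ≤ t := by linarith [ht.1]
  have ht₀t : t₀ < t := by linarith [ht.1]
  exact (lintegral_mono_set (ball_subset_ball hr'r)).trans (hall t ⟨ht₀t, ht.2⟩ ht0)

/-! ## §3 The ESS endpoint row: `limsup_{t↑T} ‖u(t)‖_{L³} = ∞` -/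

/-- **THE ESCAURIAZA–SEREGIN–ŠVERÁK ROW FOR UNFORCED CLAY BLOW-UPS**: for a Clay blow-up at `ν > 0`
with zero force, `∫_{ℝ³} |u(t)|³` is unbounded as `t ↑ T` — for every finite `C` and every `t₀ < T`
there is `t ∈ (t₀, T)`, `t ≥ 0`, with `∫ |u(t)|³ > C`. (A singular point exists on the final slice,
`exists_not_isBackwardBoundedAt`, and `L³` concentrates there, `L3_concentration_frequently`.) No named
fact. [cite: EscauriazaSereginSverak2003, Thm. 1.3 and Thm. 1.4] -/
theorem limsup_L3_eq_top (hν : 0 < ν) (hf : X.f = 0) (C : ℝ≥0) {t₀ : ℝ} (ht₀ : t₀ < X.T) :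
    ∃ t ∈ Ioo t₀ X.T, 0 ≤ t ∧ (C : ℝ≥0∞) < ∫⁻ x, ‖X.u t x‖ₑ ^ 3 := by
  obtain ⟨x₀, hx₀⟩ := X.exists_not_isBackwardBoundedAt hν
  obtain ⟨t, ht, ht0, hC⟩ := X.L3_concentration_frequently hν hf hx₀ one_pos C ht₀
  exact ⟨t, ht, ht0, hC.trans_le (setLIntegral_le_lintegral _ _)⟩

/-- **The same in the `L³` norm**: for every finite `M` and every `t₀ < T` some `t ∈ (t₀, T)` has
`‖u(t)‖_{L³(ℝ³)} > M` — an unforced Clay blow-up is never bounded in the critical space `L^∞_t L³_x`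
near its lifespan (Escauriaza–Seregin–Šverák 2003, Thm. 1.3: `limsup_{t↑T} ‖u(t)‖₃ = ∞` at a blow-up
time). No named fact. [cite: EscauriazaSereginSverak2003, Thm. 1.3] -/
theorem limsup_eLpNorm_three_eq_top (hν : 0 < ν) (hf : X.f = 0) (M : ℝ≥0) {t₀ : ℝ} (ht₀ : t₀ < X.T) :
    ∃ t ∈ Ioo t₀ X.T, 0 ≤ t ∧ (M : ℝ≥0∞) < eLpNorm (X.u t) 3 volume := by
  obtain ⟨t, ht, ht0, hC⟩ := X.limsup_L3_eq_top hν hf (M ^ 3) ht₀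
  refine ⟨t, ht, ht0, ?_⟩
  rw [eLpNorm_eq_lintegral_rpow_enorm_toReal (by norm_num) (by simp), ENNReal.toReal_ofNat]
  have e : ∫⁻ x, ‖X.u t x‖ₑ ^ (3 : ℝ) = ∫⁻ x, ‖X.u t x‖ₑ ^ 3 := by
    refine lintegral_congr fun x => ?_
    rw [show (3 : ℝ) = ((3 : ℕ) : ℝ) by norm_num, ENNReal.rpow_natCast]
  rw [e]
  have hM : (M : ℝ≥0∞) = (((M : ℝ≥0∞)) ^ 3) ^ (1 / (3 : ℝ)) := by
    rw [← ENNReal.rpow_natCast, ← ENNReal.rpow_mul]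
    norm_num
  have hC' : (M : ℝ≥0∞) ^ 3 < ∫⁻ x, ‖X.u t x‖ₑ ^ 3 := by
    rw [← ENNReal.coe_pow]
    exact hC
  rw [hM]
  exact ENNReal.rpow_lt_rpow hC' (by norm_num)

end ClayBlowup

namespace DesignedBlowup

variable {ν : ℝ} (D : DesignedBlowup ν)

/-- **`L³` concentrates at every singular point of an unforced designed blow-up** (`ν > 0`;
`toClayBlowup`). [cite: EscauriazaSereginSverak2003, Thm. 1.4 and §3] -/
theorem L3_concentration (hν : 0 < ν) (hf : D.f = 0) {x₀ : EuclideanSpace ℝ (Fin 3)}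
    (hx₀ : ¬ IsBackwardBoundedAt D.u D.T x₀) {r : ℝ} (hr : 0 < r) (hrT : r ^ 2 ≤ D.T) (C : ℝ≥0) :
    ¬ ∀ᵐ t ∂(volume.restrict (Ioo (D.T - r ^ 2) D.T)), ∫⁻ x in ball x₀ r, ‖D.u t x‖ₑ ^ 3 ≤ C :=
  D.toClayBlowup.L3_concentration hν hf hx₀ hr hrT C

/-- **The ESS row for unforced designed blow-ups**: `‖u(t)‖_{L³}` is unbounded as `t ↑ T` (`ν > 0`).
[cite: EscauriazaSereginSverak2003, Thm. 1.3] -/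
theorem limsup_eLpNorm_three_eq_top (hν : 0 < ν) (hf : D.f = 0) (M : ℝ≥0) {t₀ : ℝ}
    (ht₀ : t₀ < D.T) : ∃ t ∈ Ioo t₀ D.T, 0 ≤ t ∧ (M : ℝ≥0∞) < eLpNorm (D.u t) 3 volume :=
  D.toClayBlowup.limsup_eLpNorm_three_eq_top hν hf M ht₀

end DesignedBlowup

/-! ## §4 The (A)-side reading -/

/-- **IF CLAY (A) FAILS, EVERY WITNESS ESCAPES `L^∞_t L³_x`**: every unforced Clay blow-up, at any
`ν > 0`, has `‖u(t)‖_{L³(ℝ³)}` unbounded as `t ↑ T` and `L³` concentrating at each of its singular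
points at every scale. (`¬ NavierStokesRegularity` is equivalent to the existence of an unforced Clay
blow-up, g5/g6; nothing here asserts that one exists.) [cite: EscauriazaSereginSverak2003, Thm. 1.3]
[cite: FeffermanClay2006, (A)] -/
theorem unforced_clayBlowup_escapes_L3 {ν : ℝ} (hν : 0 < ν) (X : ClayBlowup ν) (hf : X.f = 0) :
    (∀ (M : ℝ≥0) (t₀ : ℝ), t₀ < X.T → ∃ t ∈ Ioo t₀ X.T, 0 ≤ t ∧ (M : ℝ≥0∞) < eLpNorm (X.u t) 3 volume) ∧
      ∀ x₀ : EuclideanSpace ℝ (Fin 3), ¬ IsBackwardBoundedAt X.u X.T x₀ →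
        ∀ (r : ℝ), 0 < r → ∀ (C : ℝ≥0) (t₀ : ℝ), t₀ < X.T →
          ∃ t ∈ Ioo t₀ X.T, 0 ≤ t ∧ (C : ℝ≥0∞) < ∫⁻ x in ball x₀ r, ‖X.u t x‖ₑ ^ 3 :=
  ⟨fun M _ ht₀ => X.limsup_eLpNorm_three_eq_top hν hf M ht₀,
    fun _ hx₀ _ hr C _ ht₀ => X.L3_concentration_frequently hν hf hx₀ hr C ht₀⟩

end Summit.NavierStokesRegularity.FluidComputer

end
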